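import Mathlib

/-!
# Stub `stub_psdBlocks` for crux `MatrixDescartes`, line `Lift`

Two elementary positive-semidefiniteness facts about zero-padded block-diagonal real matrices
on the index type `(Fin m × Fin K) ⊕ Fin m`, used by the PSD lift of a real symmetric lacunary
pencil `∑ₗ X^{dₗ} Sₗ` (size `m`, `K` terms):

* for each `l : Fin K` and each real `a ≥ 0`, the block matrix
  `fromBlocks (diagonal fun jl => if jl.2 = l then a else 0) 0 0 0` is positive semidefinite;
* for every positive semidefinite `N : Matrix (Fin m) (Fin m) ℝ`, the block matrix
  `fromBlocks 0 0 0 N` is positive semidefinite.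

Both follow from the general fact `posSemidef_fromBlocks_zero` (a block-diagonal real matrix
with positive semidefinite diagonal blocks is positive semidefinite), proved through the
quadratic-form characterisation `Matrix.PosSemidef.of_dotProduct_mulVec_nonneg`.
-/

set_option linter.dupNamespace false

namespace Summit.ValiantsHypothesis.ValiantsHypothesis.Theorems.LacunarySymmetroidMatrixDescartes

open Matrix

/-- A block-diagonal real matrix `fromBlocks M₁ 0 0 M₂` whose two diagonal blocks `M₁`, `M₂` are
positive semidefinite is positive semidefinite. -/
theorem posSemidef_fromBlocks_zero {m₁ m₂ : Type*} [Fintype m₁] [Fintype m₂]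
    {M₁ : Matrix m₁ m₁ ℝ} {M₂ : Matrix m₂ m₂ ℝ} (h₁ : M₁.PosSemidef) (h₂ : M₂.PosSemidef) :
    (Matrix.fromBlocks M₁ 0 0 M₂).PosSemidef := by
  -- adapted from Literature/AlgebraicGeometry/HyperbolicPolynomials/SpectrahedralShadowCalculus
  -- (`posSemidef_fromBlocks_zero_iff`, reverse direction)
  refine PosSemidef.of_dotProduct_mulVec_nonneg
    (IsHermitian.fromBlocks h₁.isHermitian (by simp) h₂.isHermitian) fun v => ?_
  have hv : v = Sum.elim (v ∘ Sum.inl) (v ∘ Sum.inr) := (Sum.elim_comp_inl_inr v).symm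
  rw [star_trivial, hv, fromBlocks_mulVec, sumElim_dotProduct_sumElim]
  simp only [Sum.elim_comp_inl, Sum.elim_comp_inr, zero_mulVec, add_zero, zero_add]
  have e₁ := h₁.dotProduct_mulVec_nonneg (v ∘ Sum.inl)
  have e₂ := h₂.dotProduct_mulVec_nonneg (v ∘ Sum.inr)
  rw [star_trivial] at e₁ e₂
  exact add_nonneg e₁ e₂

/-- **Stub `stub_psdBlocks`.** (i) For every `l : Fin K` and every real `a ≥ 0`, the
zero-padded nonnegative diagonal matrix
`fromBlocks (diagonal fun jl => if jl.2 = l then a else 0) 0 0 0` on `(Fin m × Fin K) ⊕ Fin m`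
is positive semidefinite; (ii) for every positive semidefinite `N : Matrix (Fin m) (Fin m) ℝ`,
the zero-padded matrix `fromBlocks 0 0 0 N` is positive semidefinite. -/
theorem stub_psdBlocks (K m : ℕ) :
    (∀ (l : Fin K) (a : ℝ), 0 ≤ a →
        (Matrix.fromBlocks (Matrix.diagonal fun jl : Fin m × Fin K => if jl.2 = l then a else 0)
          0 0 (0 : Matrix (Fin m) (Fin m) ℝ)).PosSemidef) ∧
    (∀ N : Matrix (Fin m) (Fin m) ℝ, N.PosSemidef →
        (Matrix.fromBlocks (0 : Matrix (Fin m × Fin K) (Fin m × Fin K) ℝ) 0 0 N).PosSemidef) := by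
  refine ⟨fun l a ha => ?_, fun N hN => ?_⟩
  · -- the diagonal block has entries `a` or `0`, all nonnegative; the other block is `0`
    refine posSemidef_fromBlocks_zero (posSemidef_diagonal_iff.2 fun jl => ?_) PosSemidef.zero
    show (0 : ℝ) ≤ if jl.2 = l then a else 0
    split_ifs
    · exact ha
    · exact le_rfl
  · exact posSemidef_fromBlocks_zero PosSemidef.zero hN

end Summit.ValiantsHypothesis.ValiantsHypothesis.Theorems.LacunarySymmetroidMatrixDescartes
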